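import Mathlib
import HarnessLib

/-!
# [OURS · L1 W4.5(b) · EL♮(3)] T-NOEXACT — the FIBRE NO-GO in RING CURRENCY: special degree over EVERY component of `C_k`
# equals the generic degree (LEAD-MEMO-4 §1(c)), so «`C'_k = Λ = ℓ⁽¹⁾_i`» has no in-carrier dominant realisation

Crux `EquisingularLiftNatThree` = stmt-ResolutionOfSingularities-20148 (child of `EquisingularLiftNat`, stmt-20038; route
EquisingularLift), theory lane of `stub_elnat_three_isolated_nontc`; helper file `--supports … --as helper` by res-D-pv-043
(res-plan-2 IDLE POOL DEAL #3, 2026-08-27T08:45:01Z, object «W4.5b U1 T-NOEXACT» of res-L1-w45b-plan-1's UNCLAIMED-STUB LIST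
08:44:06Z). HONEST FRAMING: OURS (cell res-hironaka, crux chain w45b); NOT a statement of any manuscript; NEGATIVE-SIDE
documentation of res-L1-w45b-lead-2's LEAD-MEMO-4 §1 (route T-B of K4.5e arm T: after the (E-β′) centre `C`, the new double
lines `ℓ⁽¹⁾_i ⊂ E_C` have NO exact admissible lift). AI-written, weaker than expert review. No `sorry`; standard axioms.

THE THREE CURRENCIES OF §1(b)/(c). Let `C → Spec O′` be the regular `O′`-flat relative curve (the centre), `C_k` its REDUCED
special fibre with components `A` (on S-F: seven lines `ℓ̃_i ≅ ℙ¹` and seven cubics `K_j`), `E_C = ℙ(N) → C` the exceptional divisor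
of `Bl_C`, and `C′ ⊂ X₃` a regular `O′`-flat curve with `C′_k = Λ`, `Λ = ℓ⁽¹⁾_i ⊂ E_C|_{ℓ̃_i}` a section over ONE component.
(1) NUMERICAL: `E_C · C′_K = E_C · C′_k = E_C · Λ < 0` forces `C′_K ⊂ E_C` (not typed here: intersection numbers in flat
families are not in the tree). (2) RING — THIS FILE: once `C′ ⊂ E_C` dominates `C`, `C′ → C` is finite of generic degree `d`,
and at the generic point `η_A` of EVERY component `A` of `C_k` the local ring `R_A = 𝒪_{C,η_A}` is a discrete valuation ring
whose uniformiser is the image of `ϖ′` (because `C_k` is reduced at `η_A`); the finite `R_A`-module `M_A = (π_*𝒪_{C′})_{η_A}` is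
`O′`-flat, hence `ϖ′`-regular, hence TORSION-FREE over `R_A`, hence FREE (PID): its special rank over `A` equals its generic
rank `d`. So `C′_k` has degree `d` over EVERY component — and «degree `1` over `ℓ̃_i`, degree `0` over `K_j`» (which is what
`C′_k = Λ` says) is impossible. (3) TOPOLOGICAL (the non-dominant case): if `C′_K ⊂ E_{C,K}` does not dominate `C_K` it maps to a
closed point `c` of `C_K`, so `π(C′) ⊆ D := ` closure of `c`, an irreducible one-dimensional closed subset of `C` whose special
fibre `D ∩ C_k` is FINITE — but `π(C′_k) = π(Λ) = ℓ̃_i` is a curve; so this case needs no genus input (LEAD-MEMO-4 §1(b) routes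
it through «`p_a` constant in flat families» + «`ℙ¹` does not dominate genus `≥ 1`» instead). Neither (1) nor (3) is typed here;
the `HorizChainE1`-stage packaging of the three is left to the line's holder (LEAD-MEMO-4 §4).

DECLS (ring currency; all over Mathlib's `Module.IsTorsionFree`, `IsDiscreteValuationRing`, `Module.Flat`):
* `isSMulRegular_algebraMap_of_flat` — `O′`-flat ⇒ the image of a non-zero-divisor `ϖ′` acts injectively (restriction of scalars).
* `isTorsionFree_of_isSMulRegular_of_irreducible` — over a DVR `R` with uniformiser `ϖ`, a module on which `ϖ` acts injectively
  is torsion-free (every non-zero `r` is `unit · ϖⁿ`).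
* `isTorsionFree_of_flat_of_irreducible_algebraMap` — the two combined: `M` an `R`-module flat over `O′` with
  `algebraMap O′ R ϖ′` a uniformiser of the DVR `R` ⇒ `M` torsion-free over `R`.
* `finrank_baseChange_eq_finrank_baseChange_of_isTorsionFree` — for a finite torsion-free module over a PID the ranks of ALL base
  changes to fields agree (free of rank `finrank R M`): special degree `= ` generic degree (§1(c) at one component).
* `finrank_specialFibre_eq_finrank_genericFibre` — §1(c) AS USED: `O′`-flat + uniformiser hypothesis ⇒ `finrank k_A (k_A ⊗ M_A)
  = finrank K (K ⊗ M_A)`.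
* `finrank_specialFibre_eq_of_genericFibre_equiv` — TWO components `A`, `B` with a common generic fibre
  (`K ⊗_{R_A} M_A ≃ₗ[K] K ⊗_{R_B} M_B`, `K = k(C)`): the special degrees over `A` and `B` AGREE.
* `finrank_specialFibre_ne_zero_of_eq_one` — THE NO-GO IN RING CURRENCY: special degree `1` over `A` (`Λ` over `ℓ̃_i`) forces
  special degree `1`, in particular `≠ 0`, over `B` (`K_j`): `C′_k` meets the generic point of every other component, so
  `C′_k = Λ` is impossible for an in-carrier `C′` dominating `C`.

References: OURS planning texts (index only) L/res-L1-w45b-lead-2/LEAD-MEMO-4.md §1(b)(c), §4, ERRATUM v1.1;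
L/w45b/PLANNER-MEMO-g7-2-ADDENDUM-N6.md (d); L/w45b/CHAIN.v7.4.1.md §3 row T-NOEXACT. Mathlib:
`Module.Flat.isSMulRegular_of_nonZeroDivisors`, `IsDiscreteValuationRing.eq_unit_mul_pow_irreducible`,
`Module.free_of_finite_type_torsion_free'`, `Module.finrank_baseChange`.
-/

set_option linter.dupNamespace false -- mandated namespace `Summit.<Summit>.<Problem>` of this single-conjunct summit

open scoped TensorProduct

namespace Summit.ResolutionOfSingularities.ResolutionOfSingularities.Cruxes.EquisingularLiftNat.NoExactFibre

universe u v w x y z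

/-! ## `O′`-flatness ⇒ the uniformiser acts injectively ⇒ torsion-free over the DVR at a generic point of `C_k` -/

/-- **`O′`-flat ⇒ `ϖ′`-regular.** If `M` is an `R`-module for an `O`-algebra `R`, flat as an `O`-module (restriction of scalars),
and `ϖ ∈ O` is a non-zero-divisor, then `algebraMap O R ϖ` acts injectively on `M` (flat modules are torsion-free against
non-zero-divisors, Mathlib `Module.Flat.isSMulRegular_of_nonZeroDivisors`). [folklore] -/
theorem isSMulRegular_algebraMap_of_flat {O : Type u} {R : Type v} {M : Type w} [CommRing O] [CommRing R] [Algebra O R]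
    [AddCommGroup M] [Module R M] [Module O M] [IsScalarTower O R M] [Module.Flat O M] {ϖ : O}
    (hϖ : ϖ ∈ nonZeroDivisors O) : IsSMulRegular M (algebraMap O R ϖ) := by
  have h := Module.Flat.isSMulRegular_of_nonZeroDivisors (M := M) hϖ
  intro m₁ m₂ hm
  apply h
  simpa only [algebraMap_smul] using hm

/-- **Over a DVR, `ϖ`-regular ⇒ torsion-free.** `R` a discrete valuation ring with uniformiser `ϖ` (`Irreducible ϖ`), `M` an
`R`-module on which `ϖ` acts injectively. Then `M` is torsion-free: every non-zero `r ∈ R` is `u · ϖⁿ` with `u` a unit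
(`IsDiscreteValuationRing.eq_unit_mul_pow_irreducible`), and units and powers of `ϖ` act injectively. [folklore] -/
theorem isTorsionFree_of_isSMulRegular_of_irreducible {R : Type u} [CommRing R] [IsDomain R] [IsDiscreteValuationRing R]
    {ϖ : R} (hϖ : Irreducible ϖ) {M : Type v} [AddCommGroup M] [Module R M] (h : IsSMulRegular M ϖ) :
    Module.IsTorsionFree R M where
  isSMulRegular r hr := by
    have hr0 : r ≠ 0 := hr.ne_zero
    obtain ⟨n, u, rfl⟩ := IsDiscreteValuationRing.eq_unit_mul_pow_irreducible hr0 hϖ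
    exact (Units.isSMulRegular M u).mul (h.pow n)

/-- **The two combined (LEAD-MEMO-4 §1(c), local input).** `R` a discrete valuation ring and an `O`-algebra in which the image
of `ϖ ∈ O` (a non-zero-divisor of `O`) is a UNIFORMISER — in the application `R = 𝒪_{C,η_A}`, `O = O′`, and this says the special
fibre `C_k` is reduced at the generic point `η_A` of the component `A`; `M` an `R`-module flat over `O`. Then `M` is torsion-free
over `R`. [folklore] -/
theorem isTorsionFree_of_flat_of_irreducible_algebraMap {O : Type u} {R : Type v} {M : Type w} [CommRing O] [CommRing R]
    [IsDomain R] [IsDiscreteValuationRing R] [Algebra O R] [AddCommGroup M] [Module R M] [Module O M] [IsScalarTower O R M]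
    [Module.Flat O M] {ϖ : O} (hϖ : ϖ ∈ nonZeroDivisors O) (hunif : Irreducible (algebraMap O R ϖ)) :
    Module.IsTorsionFree R M :=
  isTorsionFree_of_isSMulRegular_of_irreducible hunif (isSMulRegular_algebraMap_of_flat hϖ)

/-! ## Special degree = generic degree (§1(c)) -/

/-- **All field base changes of a finite torsion-free module over a PID have the same rank** (the module is free, Mathlib
`Module.free_of_finite_type_torsion_free'`, and `finrank` of a base change of a free module is its rank,
`Module.finrank_baseChange`). With `k = ` the residue field and `K = ` the fraction field of `R = 𝒪_{C,η_A}`: the special degree of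
`C′` over the component `A` equals the generic degree. [folklore] -/
theorem finrank_baseChange_eq_finrank_baseChange_of_isTorsionFree {R : Type u} [CommRing R] [IsDomain R]
    [IsPrincipalIdealRing R] (M : Type v) [AddCommGroup M] [Module R M] [Module.Finite R M] [Module.IsTorsionFree R M]
    (k : Type x) [Field k] [Algebra R k] (K : Type y) [Field K] [Algebra R K] :
    Module.finrank k (k ⊗[R] M) = Module.finrank K (K ⊗[R] M) := by
  rw [Module.finrank_baseChange, Module.finrank_baseChange]

/-- **§1(c) AS USED — special degree over a component = generic degree.** `R = 𝒪_{C,η_A}` a DVR, `O = O′ → R` with `ϖ′ ↦` a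
uniformiser (`C_k` reduced at `η_A`), `M = (π_*𝒪_{C′})_{η_A}` finite over `R` and flat over `O′` (`C′ → C` finite, `C′` `O′`-flat);
`k` the residue field of `A`'s generic point, `K = k(C)` (any fields over `R`): `finrank k (k ⊗ M) = finrank K (K ⊗ M)`.
[folklore] -/
theorem finrank_specialFibre_eq_finrank_genericFibre {O : Type u} {R : Type v} [CommRing O] [CommRing R] [IsDomain R]
    [IsDiscreteValuationRing R] [Algebra O R] {ϖ : O} (hϖ : ϖ ∈ nonZeroDivisors O)
    (hunif : Irreducible (algebraMap O R ϖ)) (M : Type w) [AddCommGroup M] [Module R M] [Module O M] [IsScalarTower O R M]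
    [Module.Finite R M] [Module.Flat O M] (k : Type x) [Field k] [Algebra R k] (K : Type y) [Field K] [Algebra R K] :
    Module.finrank k (k ⊗[R] M) = Module.finrank K (K ⊗[R] M) := by
  haveI := isTorsionFree_of_flat_of_irreducible_algebraMap (M := M) hϖ hunif
  exact finrank_baseChange_eq_finrank_baseChange_of_isTorsionFree M k K

/-! ## Two components with a common generic fibre: the no-go -/

/-- **Componentwise constancy (LEAD-MEMO-4 §1(c)): the special degrees over two components AGREE.** `R₁ = 𝒪_{C,η_A}` and
`R₂ = 𝒪_{C,η_B}` discrete valuation rings at the generic points of two components of `C_k`, both `O′`-algebras with `ϖ′ ↦`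
uniformisers; `M₁`, `M₂` the stalks of `π_*𝒪_{C′}` there (finite, `O′`-flat); `K = k(C)` a field over both, in which the two
stalks have THE SAME generic fibre `e : K ⊗_{R₁} M₁ ≃ₗ[K] K ⊗_{R₂} M₂` (both are `(π_*𝒪_{C′})_{η_C} `). Then
`finrank k₁ (k₁ ⊗ M₁) = finrank k₂ (k₂ ⊗ M₂)` for any fields `k₁ / R₁`, `k₂ / R₂` (the residue fields). [folklore] -/
theorem finrank_specialFibre_eq_of_genericFibre_equiv {O : Type u} {R₁ R₂ : Type v} [CommRing O] [CommRing R₁] [IsDomain R₁]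
    [IsDiscreteValuationRing R₁] [Algebra O R₁] [CommRing R₂] [IsDomain R₂] [IsDiscreteValuationRing R₂] [Algebra O R₂]
    {ϖ : O} (hϖ : ϖ ∈ nonZeroDivisors O) (h₁ : Irreducible (algebraMap O R₁ ϖ)) (h₂ : Irreducible (algebraMap O R₂ ϖ))
    (M₁ : Type w) [AddCommGroup M₁] [Module R₁ M₁] [Module O M₁] [IsScalarTower O R₁ M₁] [Module.Finite R₁ M₁]
    [Module.Flat O M₁]
    (M₂ : Type w) [AddCommGroup M₂] [Module R₂ M₂] [Module O M₂] [IsScalarTower O R₂ M₂] [Module.Finite R₂ M₂]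
    [Module.Flat O M₂]
    (K : Type x) [Field K] [Algebra R₁ K] [Algebra R₂ K] (e : K ⊗[R₁] M₁ ≃ₗ[K] K ⊗[R₂] M₂)
    (k₁ : Type y) [Field k₁] [Algebra R₁ k₁] (k₂ : Type z) [Field k₂] [Algebra R₂ k₂] :
    Module.finrank k₁ (k₁ ⊗[R₁] M₁) = Module.finrank k₂ (k₂ ⊗[R₂] M₂) := by
  rw [finrank_specialFibre_eq_finrank_genericFibre hϖ h₁ M₁ k₁ K,
    finrank_specialFibre_eq_finrank_genericFibre hϖ h₂ M₂ k₂ K]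
  exact e.finrank_eq

/-- **T-NOEXACT in ring currency (OURS).** In the situation of `finrank_specialFibre_eq_of_genericFibre_equiv`: if the special
degree over the component `A` is `1` — `C′_k` is the SECTION `Λ = ℓ⁽¹⁾_i` over `A = ℓ̃_i` — then the special degree over every other
component `B` (a cubic `K_j`) is `1` as well, in particular NON-ZERO: `C′_k` passes through the generic point of `E_C|_B`. Hence
no `O′`-flat in-carrier `C′` dominating `C` has special fibre `Λ` alone; with currencies (1) and (3) of the file docstring this is
LEAD-MEMO-4 §1(b): the CJS step «blow up the double line `ℓ⁽¹⁾_i`» has no exact shadow. [folklore] -/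
theorem finrank_specialFibre_ne_zero_of_eq_one {O : Type u} {R₁ R₂ : Type v} [CommRing O] [CommRing R₁] [IsDomain R₁]
    [IsDiscreteValuationRing R₁] [Algebra O R₁] [CommRing R₂] [IsDomain R₂] [IsDiscreteValuationRing R₂] [Algebra O R₂]
    {ϖ : O} (hϖ : ϖ ∈ nonZeroDivisors O) (h₁ : Irreducible (algebraMap O R₁ ϖ)) (h₂ : Irreducible (algebraMap O R₂ ϖ))
    (M₁ : Type w) [AddCommGroup M₁] [Module R₁ M₁] [Module O M₁] [IsScalarTower O R₁ M₁] [Module.Finite R₁ M₁]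
    [Module.Flat O M₁]
    (M₂ : Type w) [AddCommGroup M₂] [Module R₂ M₂] [Module O M₂] [IsScalarTower O R₂ M₂] [Module.Finite R₂ M₂]
    [Module.Flat O M₂]
    (K : Type x) [Field K] [Algebra R₁ K] [Algebra R₂ K] (e : K ⊗[R₁] M₁ ≃ₗ[K] K ⊗[R₂] M₂)
    (k₁ : Type y) [Field k₁] [Algebra R₁ k₁] (k₂ : Type z) [Field k₂] [Algebra R₂ k₂]
    (hA : Module.finrank k₁ (k₁ ⊗[R₁] M₁) = 1) :
    Module.finrank k₂ (k₂ ⊗[R₂] M₂) = 1 ∧ Nontrivial (k₂ ⊗[R₂] M₂) := by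
  have hB : Module.finrank k₂ (k₂ ⊗[R₂] M₂) = 1 := by
    rw [← finrank_specialFibre_eq_of_genericFibre_equiv hϖ h₁ h₂ M₁ M₂ K e k₁ k₂, hA]
  exact ⟨hB, Module.nontrivial_of_finrank_eq_succ hB⟩

end Summit.ResolutionOfSingularities.ResolutionOfSingularities.Cruxes.EquisingularLiftNat.NoExactFibre
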